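import Literature.NumberTheory.NumberFields.StickelbergerGaussSum
import HarnessLib

/-!
# Group-ring exponents for `ℚ(ζ_p)`: `Y^θ = ∏_c σ_c(Y)^{n_c}` on elements and ideals

[Schoof2009, Ch. 7, p. 38]: "All groups defined so far are modules over the group ring `ℤ[G]` … We
sometimes use exponential notation for the action of `ℤ[G]` on multiplicative groups."  For the plus
argument ([Schoof2009, Ch. 14]) we need this exponential calculus for elements of `K = ℚ(ζ_p)`, of
`𝓞 K`, and for ideals of `𝓞 K`, with **natural-number exponent vectors** `n : (ℤ/p)ˣ → ℕ`
(`θ = ∑_c n_c σ_c`, `σ_c = Stickelberger.gal p K c`, `σ_c ζ = ζ^c`):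

* `Y^n = ∏_c σ_c(Y)^{n_c}`, `I^n = ∏_c σ_c(I)^{n_c}`;
* multiplicativity in `Y`/`I`, additivity in `n`;
* `σ_a(Y^n) = Y^{n(a⁻¹ ·)}` and the composition rule `(Y^{n'})^{n} = Y^{n ⋆ n'}` for the convolution
  `(n ⋆ n')(c) = ∑_a n(a) n'(a⁻¹ c)` (the product in `ℕ[G]`);
* `(span {Y})^n = span {Y^n}`, `𝔭^n = 𝔭^{∑ n}` for `𝔭 = (ζ - 1)`;
* reduction of exponents modulo `q`: `Y^n = Y^{n'} · (Y^d)^q` when `n = n' + q d`.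

To keep the file free of definitions (it is a proofs file, D-0026) the three operations and the
convolution are taken as *parameters* `pw, pwO, ipw, conv` pinned down by hypotheses `hpw, hpwO, hipw,
hconv` stating the defining formulas; users instantiate them with the corresponding lambda terms.

## References

* R. Schoof, *Catalan's Conjecture*, Universitext, Springer 2009, Ch. 7 (p. 38) and Ch. 14.
  [Schoof2009]
-/

open NumberField Finset
open scoped Pointwise

namespace Literature.NumberTheory.DiophantineGeometry

namespace Catalan.GalPow

open Literature.NumberTheory.NumberFields.Stickelberger

variable {p : ℕ} [hp : Fact p.Prime] {K : Type*} [Field K] [NumberField K]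
  [hK : IsCyclotomicExtension {p} ℚ K]

/-! ### Convolution of exponent vectors -/

section Conv

variable (conv : ((ZMod p)ˣ → ℕ) → ((ZMod p)ˣ → ℕ) → ((ZMod p)ˣ → ℕ))
  (hconv : ∀ n n' c, conv n n' c = ∑ a, n a * n' (a⁻¹ * c))

include hconv in
/-- `∑_c (n ⋆ n')(c) = (∑ n)(∑ n')`. [folklore] -/
theorem sum_conv (n n' : (ZMod p)ˣ → ℕ) : ∑ c, conv n n' c = (∑ a, n a) * ∑ b, n' b := by
  simp_rw [hconv]
  rw [Finset.sum_comm, Finset.sum_mul]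
  refine Finset.sum_congr rfl fun a _ => ?_
  rw [Finset.mul_sum]
  exact Fintype.sum_equiv (Equiv.mulLeft a⁻¹) _ _ fun c => rfl

include hconv in
/-- The convolution of even vectors is even (`n(-c) = n(c)`). [folklore] -/
theorem conv_neg (n n' : (ZMod p)ˣ → ℕ) (hn' : ∀ c, n' (-c) = n' c) (c : (ZMod p)ˣ) :
    conv n n' (-c) = conv n n' c := by
  simp_rw [hconv]
  refine Finset.sum_congr rfl fun a _ => ?_
  rw [mul_neg, hn']

include hconv in
/-- Pointwise congruence passes to convolutions. [folklore] -/
theorem conv_modEq {q : ℕ} {n₁ n₂ n' : (ZMod p)ˣ → ℕ} (h : ∀ c, n₁ c ≡ n₂ c [MOD q]) (c : (ZMod p)ˣ) :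
    conv n₁ n' c ≡ conv n₂ n' c [MOD q] := by
  rw [hconv, hconv]
  exact Nat.ModEq.sum fun a _ => (h a).mul_right _

include hconv in
/-- Pointwise congruence passes to convolutions (right factor). [folklore] -/
theorem conv_modEq_right {q : ℕ} {n n₁ n₂ : (ZMod p)ˣ → ℕ} (h : ∀ c, n₁ c ≡ n₂ c [MOD q])
    (c : (ZMod p)ˣ) : conv n n₁ c ≡ conv n n₂ c [MOD q] := by
  rw [hconv, hconv]
  exact Nat.ModEq.sum fun a _ => (h _).mul_left _

end Conv

/-! ### Powers of elements of `K` -/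

section Elem

variable (pw : K → ((ZMod p)ˣ → ℕ) → K) (hpw : ∀ Y n, pw Y n = ∏ c, (gal p K c Y) ^ n c)

include hpw in
/-- `(Y Y')^n = Y^n Y'^n`. [cite: Schoof2009, Ch. 7 (p. 38)] -/
theorem pw_mul (Y Y' : K) (n : (ZMod p)ˣ → ℕ) : pw (Y * Y') n = pw Y n * pw Y' n := by
  simp_rw [hpw, map_mul, mul_pow, Finset.prod_mul_distrib]

include hpw in
/-- `Y^{n+n'} = Y^n Y^{n'}`. [cite: Schoof2009, Ch. 7 (p. 38)] -/
theorem pw_add (Y : K) (n n' : (ZMod p)ˣ → ℕ) :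
    pw Y (fun c => n c + n' c) = pw Y n * pw Y n' := by
  simp_rw [hpw, pow_add, Finset.prod_mul_distrib]

include hpw in
/-- `Y^{k n} = (Y^n)^k`. [cite: Schoof2009, Ch. 7 (p. 38)] -/
theorem pw_smul (Y : K) (n : (ZMod p)ˣ → ℕ) (k : ℕ) :
    pw Y (fun c => k * n c) = pw Y n ^ k := by
  simp_rw [hpw, ← Finset.prod_pow]
  refine Finset.prod_congr rfl fun c _ => ?_
  rw [mul_comm, pow_mul]

include hpw in
/-- `1^n = 1`. [folklore] -/
theorem pw_one (n : (ZMod p)ˣ → ℕ) : pw 1 n = 1 := by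
  simp_rw [hpw, map_one, one_pow, Finset.prod_const_one]

include hpw in
/-- `Y^0 = 1`. [folklore] -/
theorem pw_zero (Y : K) : pw Y (fun _ => 0) = 1 := by
  simp_rw [hpw, pow_zero, Finset.prod_const_one]

include hpw in
/-- `Y ≠ 0 ⟹ Y^n ≠ 0`. [folklore] -/
theorem pw_ne_zero {Y : K} (hY : Y ≠ 0) (n : (ZMod p)ˣ → ℕ) : pw Y n ≠ 0 := by
  rw [hpw]
  exact Finset.prod_ne_zero_iff.mpr fun c _ => pow_ne_zero _ ((map_ne_zero_iff _ (gal p K c).injective).mpr hY)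

include hpw in
/-- `(Y^k)^n = (Y^n)^k`. [folklore] -/
theorem pw_pow (Y : K) (n : (ZMod p)ˣ → ℕ) (k : ℕ) : pw (Y ^ k) n = pw Y n ^ k := by
  simp_rw [hpw, map_pow, ← Finset.prod_pow]
  refine Finset.prod_congr rfl fun c _ => ?_
  rw [← pow_mul, ← pow_mul, mul_comm]

include hpw in
/-- **Galois conjugates of a power**: `σ_a(Y^n) = Y^{n(a⁻¹ ·)}`. [cite: Schoof2009, Ch. 7 (p. 38)] -/
theorem gal_pw (a : (ZMod p)ˣ) (Y : K) (n : (ZMod p)ˣ → ℕ) :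
    gal p K a (pw Y n) = pw Y (fun c => n (a⁻¹ * c)) := by
  simp_rw [hpw, map_prod, map_pow]
  refine Fintype.prod_equiv (Equiv.mulLeft a) _ _ fun c => ?_
  simp only [Equiv.coe_mulLeft, inv_mul_cancel_left]
  rw [gal_mul, AlgEquiv.mul_apply]

include hpw in
/-- **Composition rule**: `(Y^{n'})^{n} = Y^{n ⋆ n'}` with `(n ⋆ n')(c) = ∑_a n(a) n'(a⁻¹ c)` (the
product in the group ring). [cite: Schoof2009, Ch. 7 (p. 38)] -/
theorem pw_pw (conv : ((ZMod p)ˣ → ℕ) → ((ZMod p)ˣ → ℕ) → ((ZMod p)ˣ → ℕ))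
    (hconv : ∀ n n' c, conv n n' c = ∑ a, n a * n' (a⁻¹ * c)) (Y : K) (n n' : (ZMod p)ˣ → ℕ) :
    pw (pw Y n') n = pw Y (conv n n') := by
  conv_lhs => rw [hpw]
  simp_rw [gal_pw pw hpw, hpw, ← Finset.prod_pow, ← pow_mul]
  rw [Finset.prod_comm]
  refine Finset.prod_congr rfl fun c _ => ?_
  rw [Finset.prod_pow_eq_pow_sum, hconv]
  refine congrArg _ (Finset.sum_congr rfl fun a _ => ?_)
  rw [mul_comm]

include hpw in
/-- **Reduction of exponents modulo `q`**: if `n = n' + q d` pointwise then `Y^n = Y^{n'} (Y^d)^q`.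
[folklore] -/
theorem pw_eq_mul_pow (Y : K) {q : ℕ} {n n' d : (ZMod p)ˣ → ℕ} (h : ∀ c, n c = n' c + q * d c) :
    pw Y n = pw Y n' * pw Y d ^ q := by
  rw [← pw_smul pw hpw, ← pw_add pw hpw]
  congr 1
  funext c
  exact h c

include hpw in
/-- Two exponent vectors congruent modulo `q` give powers differing by `q`-th powers:
`Y^n · Z^q = Y^{n'} · W^q` with `Z, W ≠ 0`. [folklore] -/
theorem exists_pw_mul_pow_eq {Y : K} (hY : Y ≠ 0) {q : ℕ} {n n' : (ZMod p)ˣ → ℕ}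
    (h : ∀ c, n c ≡ n' c [MOD q]) :
    ∃ Z W : K, Z ≠ 0 ∧ W ≠ 0 ∧ pw Y n * Z ^ q = pw Y n' * W ^ q := by
  -- `n + q (n'/q) + (n' % q) = n' + q (n/q) + (n % q)` and `n % q = n' % q`
  refine ⟨pw Y (fun c => n' c / q), pw Y (fun c => n c / q), pw_ne_zero pw hpw hY _,
    pw_ne_zero pw hpw hY _, ?_⟩
  rw [← pw_smul pw hpw, ← pw_smul pw hpw, ← pw_add pw hpw, ← pw_add pw hpw]
  congr 1
  funext c
  have h1 := Nat.mod_add_div (n c) q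
  have h2 := Nat.mod_add_div (n' c) q
  have h3 : n c % q = n' c % q := h c
  omega

include hpw in
/-- For an even vector `n` and `ι = σ_{-1}`: `Y^n = σ_{-1}(Y)^n`, hence `Y^n` is `ι`-invariant.
[cite: Schoof2009, Ch. 7 (p. 39, plus parts)] -/
theorem gal_neg_one_pw (Y : K) {n : (ZMod p)ˣ → ℕ} (hn : ∀ c, n (-c) = n c) :
    gal p K (-1) (pw Y n) = pw Y n := by
  rw [gal_pw pw hpw]
  congr 1
  funext c
  rw [inv_neg, inv_one, neg_one_mul, hn]

end Elem

/-! ### Powers of algebraic integers -/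

section Integer

variable (pw : K → ((ZMod p)ˣ → ℕ) → K) (hpw : ∀ Y n, pw Y n = ∏ c, (gal p K c Y) ^ n c)
variable (pwO : 𝓞 K → ((ZMod p)ˣ → ℕ) → 𝓞 K) (hpwO : ∀ Y n, pwO Y n = ∏ c, (gal p K c • Y) ^ n c)

include hpw hpwO in
/-- The integral and the field version agree: `(Y^n : 𝓞 K) = (Y : K)^n`. [folklore] -/
theorem coe_pwO (Y : 𝓞 K) (n : (ZMod p)ˣ → ℕ) : ((pwO Y n : 𝓞 K) : K) = pw (Y : K) n := by
  rw [hpwO, hpw]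
  push_cast
  rfl

include hpwO in
/-- `(Y Y')^n = Y^n Y'^n` in `𝓞 K`. [folklore] -/
theorem pwO_mul (Y Y' : 𝓞 K) (n : (ZMod p)ˣ → ℕ) : pwO (Y * Y') n = pwO Y n * pwO Y' n := by
  simp_rw [hpwO, smul_mul', mul_pow, Finset.prod_mul_distrib]

include hpwO in
/-- `Y ≠ 0 ⟹ Y^n ≠ 0` in `𝓞 K`. [folklore] -/
theorem pwO_ne_zero {Y : 𝓞 K} (hY : Y ≠ 0) (n : (ZMod p)ˣ → ℕ) : pwO Y n ≠ 0 := by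
  rw [hpwO]
  refine Finset.prod_ne_zero_iff.mpr fun c _ => pow_ne_zero _ fun h => hY ?_
  have := congrArg (fun z => (gal p K c)⁻¹ • z) h
  simpa using this

include hpwO in
/-- `σ_a(Y^n) = Y^{n(a⁻¹·)}` in `𝓞 K`. [folklore] -/
theorem gal_smul_pwO (a : (ZMod p)ˣ) (Y : 𝓞 K) (n : (ZMod p)ˣ → ℕ) :
    gal p K a • pwO Y n = pwO Y (fun c => n (a⁻¹ * c)) := by
  simp_rw [hpwO, Finset.smul_prod', smul_pow', ← mul_smul, ← gal_mul]
  refine Fintype.prod_equiv (Equiv.mulLeft a) _ _ fun c => ?_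
  simp only [Equiv.coe_mulLeft, inv_mul_cancel_left]

include hpwO in
/-- Divisibility passes to powers: `Y ∣ Y' ⟹ Y^n ∣ Y'^n`. [folklore] -/
theorem pwO_dvd_pwO {Y Y' : 𝓞 K} (h : Y ∣ Y') (n : (ZMod p)ˣ → ℕ) : pwO Y n ∣ pwO Y' n := by
  obtain ⟨Z, rfl⟩ := h
  rw [pwO_mul pwO hpwO]
  exact dvd_mul_right _ _

end Integer

/-! ### Powers of ideals -/

section IdealPow

variable (pwO : 𝓞 K → ((ZMod p)ˣ → ℕ) → 𝓞 K) (hpwO : ∀ Y n, pwO Y n = ∏ c, (gal p K c • Y) ^ n c)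
variable (ipw : Ideal (𝓞 K) → ((ZMod p)ˣ → ℕ) → Ideal (𝓞 K))
  (hipw : ∀ I n, ipw I n = ∏ c, (gal p K c • I) ^ n c)

include hipw in
/-- `(I J)^n = I^n J^n`. [cite: Schoof2009, Ch. 7 (p. 38)] -/
theorem ipw_mul (I J : Ideal (𝓞 K)) (n : (ZMod p)ˣ → ℕ) : ipw (I * J) n = ipw I n * ipw J n := by
  simp_rw [hipw, smul_mul', mul_pow, Finset.prod_mul_distrib]

include hipw in
/-- `I^{n+n'} = I^n I^{n'}`. [folklore] -/
theorem ipw_add (I : Ideal (𝓞 K)) (n n' : (ZMod p)ˣ → ℕ) :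
    ipw I (fun c => n c + n' c) = ipw I n * ipw I n' := by
  simp_rw [hipw, pow_add, Finset.prod_mul_distrib]

include hipw in
/-- `(I^k)^n = (I^n)^k`. [folklore] -/
theorem ipw_pow (I : Ideal (𝓞 K)) (n : (ZMod p)ˣ → ℕ) (k : ℕ) : ipw (I ^ k) n = ipw I n ^ k := by
  simp_rw [hipw, smul_pow', ← Finset.prod_pow]
  refine Finset.prod_congr rfl fun c _ => ?_
  rw [← pow_mul, ← pow_mul, mul_comm]

include hipw in
/-- `⊤^n = ⊤`. [folklore] -/
theorem ipw_top (n : (ZMod p)ˣ → ℕ) : ipw ⊤ n = ⊤ := by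
  rw [hipw, ← Ideal.one_eq_top]
  refine Finset.prod_eq_one fun c _ => ?_
  have h1 : gal p K c • (1 : Ideal (𝓞 K)) = 1 := by
    rw [Ideal.one_eq_top, Ideal.pointwise_smul_def, Ideal.map_top]
  rw [h1, one_pow]

include hipw in
/-- `I ≠ 0 ⟹ I^n ≠ 0`. [folklore] -/
theorem ipw_ne_bot {I : Ideal (𝓞 K)} (hI : I ≠ ⊥) (n : (ZMod p)ˣ → ℕ) : ipw I n ≠ ⊥ := by
  rw [hipw]
  refine Finset.prod_ne_zero_iff.mpr fun c _ => pow_ne_zero _ fun h => hI ?_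
  have := congrArg (fun J : Ideal (𝓞 K) => (gal p K c)⁻¹ • J) h
  simpa using this

include hpwO hipw in
/-- **`(Y)^n = (Y^n)`** for principal ideals. [cite: Schoof2009, Ch. 7 (p. 38)] -/
theorem ipw_span_singleton (Y : 𝓞 K) (n : (ZMod p)ˣ → ℕ) :
    ipw (Ideal.span {Y}) n = Ideal.span {pwO Y n} := by
  simp_rw [hipw, hpwO, Ideal.pointwise_smul_def, Ideal.map_span, Set.image_singleton,
    Ideal.span_singleton_pow, Ideal.prod_span_singleton]
  rfl

include hipw in
/-- `σ_a(I^n) = I^{n(a⁻¹·)}`. [folklore] -/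
theorem gal_smul_ipw (a : (ZMod p)ˣ) (I : Ideal (𝓞 K)) (n : (ZMod p)ˣ → ℕ) :
    gal p K a • ipw I n = ipw I (fun c => n (a⁻¹ * c)) := by
  simp_rw [hipw, Finset.smul_prod', smul_pow', ← mul_smul, ← gal_mul]
  refine Fintype.prod_equiv (Equiv.mulLeft a) _ _ fun c => ?_
  simp only [Equiv.coe_mulLeft, inv_mul_cancel_left]

include hipw in
/-- **Composition rule for ideals**: `(I^{n'})^{n} = I^{n ⋆ n'}`. [cite: Schoof2009, Ch. 7 (p. 38)] -/
theorem ipw_ipw (conv : ((ZMod p)ˣ → ℕ) → ((ZMod p)ˣ → ℕ) → ((ZMod p)ˣ → ℕ))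
    (hconv : ∀ n n' c, conv n n' c = ∑ a, n a * n' (a⁻¹ * c)) (I : Ideal (𝓞 K))
    (n n' : (ZMod p)ˣ → ℕ) : ipw (ipw I n') n = ipw I (conv n n') := by
  conv_lhs => rw [hipw]
  simp_rw [gal_smul_ipw ipw hipw, hipw, ← Finset.prod_pow, ← pow_mul]
  rw [Finset.prod_comm]
  refine Finset.prod_congr rfl fun c _ => ?_
  rw [Finset.prod_pow_eq_pow_sum, hconv]
  refine congrArg _ (Finset.sum_congr rfl fun a _ => ?_)
  rw [mul_comm]

include hipw in
/-- **`𝔭^n = 𝔭^{∑ n}`** for the prime `𝔭 = (ζ - 1)` above `p`, which is fixed by every `σ_c`.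
[cite: Schoof2009, Exercise 7.2] -/
theorem ipw_span_zeta_sub_one {ζ : K} (hζ : IsPrimitiveRoot ζ p) (n : (ZMod p)ˣ → ℕ) :
    ipw (Ideal.span {hζ.toInteger - 1}) n = Ideal.span {hζ.toInteger - 1} ^ ∑ c, n c := by
  rw [hipw, ← Finset.prod_pow_eq_pow_sum]
  refine Finset.prod_congr rfl fun c _ => ?_
  congr 1
  -- `σ_c (ζ - 1) = ζ^c - 1` is associated to `ζ - 1`
  rw [Ideal.pointwise_smul_def, Ideal.map_span, Set.image_singleton]
  change Ideal.span {gal p K c • (hζ.toInteger - 1)} = _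
  rw [smul_sub, smul_one, gal_smul_of_pow_eq c (by
    apply Subtype.ext; exact hζ.pow_eq_one)]
  refine (Ideal.span_singleton_eq_span_singleton.mpr ?_).symm
  refine hζ.toInteger_isPrimitiveRoot.associated_sub_one_pow_sub_one_of_coprime ?_
  have h0 : (c : ZMod p).val ≠ 0 := by
    rw [Ne, ZMod.val_eq_zero]
    exact c.ne_zero
  exact (Nat.coprime_of_lt_prime h0 (ZMod.val_lt _) hp.out).symm

end IdealPow

end Catalan.GalPow

end Literature.NumberTheory.DiophantineGeometry
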